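import Summits.CriticalPhenomena.CardyFormulaZ2.Theorems.CardyMagicRigidityComposeAudit

/-!
# `NestingRigidity` (stmt-CriticalPhenomena-4835) — summit-strength certificate for the tribunal
# (crux-strategist r1, redirect seat, 2026-08-17)

Route `CardyMagicRigidity`, sub-problem `CardyFormulaZ2`.  The crux is literally
`NestingRigidity ≡ MagicFormulaZ2 → MagicFormulaT → LoopLimitZ2EqT` (Disproof §0, `Iff.rfl`).
This sorry-free file records, as kernel-checked implications over the route's own decls and the
theorems already landed under `Theorems/`, the facts the pre-birth / redirect tribunal needs in order
to rule on the BLOCKED crux: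

* §1  GIVEN THE ROUTE'S OTHER TWO TRANSFORM CRUXES the crux IS the target:
      `MagicFormulaZ2 → MagicFormulaT → (NestingRigidity ↔ LoopLimitZ2EqT)`, and the target gives the
      conjunct (`cardyFormulaZ2_of_loopLimitZ2EqT`, landed in `…ComposeAudit`), so
      `MagicFormulaZ2 → MagicFormulaT → NestingRigidity → CardyFormulaZ2`.
* §2  T1′ (conjunct residue): modulo the cited input fact `dklm2026_corollary10` (= `MagicFormulaZ2`),
      the two OPEN cruxes of the route, `MagicFormulaT` (rank 4) and `NestingRigidity` (rank 3), are
      JOINTLY EQUIVALENT to `LoopLimitZ2EqT ∧ TransferContinuity` (target + an M-sized support lemma),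
      i.e. they are a bridge split `T ∧ (T → X)` of the target with `T = MagicFormulaT` a CONSEQUENCE
      of `X`.  `X → CardyFormulaZ2` is in the tree; `CardyFormulaZ2 → X` is the Camia–Newman programme
      (print: Camia–Newman 2006 Thm 6 on 𝕋; Binder–Chayes–Lei 2010 for the SLE₆ step from Cardy on
      general lattices) — not formalised, cited only in this docstring.
* §3  THE GAUSSIAN VALUE IS INERT: with `ElectricAgreement` := the conclusion of `TransferContinuity`
      (the two lattice transforms have asymptotically equal values, no limit named),
      `MagicFormulaZ2 → (NestingRigidity ↔ (ElectricAgreement → LoopLimitZ2EqT))`.  Any proof of the crux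
      is a proof that asymptotic agreement of the `μ = 1/6` electric sectors of bond-ℤ² and site-𝕋
      forces `d_CN`-universality; the integrable input (`σ² = 3/π`, Bethe ansatz) can enter only through
      an ABSOLUTE identification `Λ_P = G ⇒ P = CLE₆`, which is the wall `BlindRigidity` of the four
      strategy censuses (no mechanism in print: Miller–Watson–Wilson arXiv:1401.0218 §8 Question 4).
* §4  A NEW NEGATIVE RUNG (finite shadow of the wall, with positivity): on the magic ellipse
      `{(w(λ), w(−λ)) : λ ∈ ℝ}`, `w(x) = 2cos(x + π/3)`, one has `w(λ)² + w(λ)w(−λ) + w(−λ)² = 3`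
      identically, so two DISTINCT probability laws of a pair of nesting counts `(N₁, N₂)` —
      `δ_(0,0)` and `(1−ε)δ_(0,0) + (ε/3)(δ_(2,0) + δ_(1,1) + δ_(0,2))` — have the same two-point
      electric data `E[w(λ)^{N₁} w(−λ)^{N₂}]` for EVERY `λ`: positivity and normalisation do not rescue
      injectivity of the `k`-point reduction (complements the dimension count S6⁺ of the s1+p1 census and
      the disprover's finite-CONFIGURATION injectivity `finiteConfig_transform_injective`, Disproof §7,
      which uses the full infinite-dimensional test family instead).

Nothing here is a proof of, or a counterexample to, the crux; §1–§3 are pure logic over landed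
theorems, §4 is trigonometry.  See `STRATEGY-CENSUS.md` (r1 section) for the census these support.
-/

noncomputable section

namespace Summit.CriticalPhenomena.CardyFormulaZ2.Cruxes.NestingRigidity.SummitStrength

open Summit.CriticalPhenomena.CardyFormulaZ2.Theses.CardyMagicRigidity
open Summit.CriticalPhenomena.CardyFormulaZ2.Theorems
  (cardyFormulaZ2_of_loopLimitZ2EqT magicFormulaT_of_loopLimitZ2EqT
    transferContinuity_of_magicFormulas magicFormulaZ2_of_dklm2026)
open Literature.Probability.Percolation (dklm2026_corollary10)
open Real

/-! ## §1 Given the two transform cruxes, the crux is the target -/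

/-- **Conditional identity of the crux with the target.**  Under the route's other two transform
cruxes `MagicFormulaZ2` (the cited DKLM fact) and `MagicFormulaT` (open, rank 4), `NestingRigidity`
and the target `X = LoopLimitZ2EqT` are the same proposition. [folklore] -/
theorem nestingRigidity_iff_target (h2 : MagicFormulaZ2) (h4 : MagicFormulaT) :
    NestingRigidity ↔ LoopLimitZ2EqT :=
  ⟨fun h3 ↦ h3 h2 h4, fun hX _ _ ↦ hX⟩

/-- **The crux reaches the conjunct, given the two transform cruxes** — through the landed
`cardyFormulaZ2_of_loopLimitZ2EqT` (= `LoopsToCrossings_of` + `smirnovTri_proof`). [folklore] -/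
theorem cardyFormulaZ2_of_nestingRigidity (h2 : MagicFormulaZ2) (h4 : MagicFormulaT)
    (h3 : NestingRigidity) : _root_.CardyFormulaZ2 :=
  cardyFormulaZ2_of_loopLimitZ2EqT (h3 h2 h4)

/-- The target alone gives the crux (restated from Disproof §0 for self-containedness). [folklore] -/
theorem nestingRigidity_of_target (hX : LoopLimitZ2EqT) : NestingRigidity := fun _ _ ↦ hX

/-! ## §2 T1′ — the two open cruxes are a bridge split of the target -/

/-- **Joint conjunct (exact form).**  Given `MagicFormulaZ2`, the pair of open cruxes
`MagicFormulaT ∧ NestingRigidity` is equivalent to `LoopLimitZ2EqT ∧ TransferContinuity`: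
`→` is modus ponens plus `transferContinuity_of_magicFormulas` (equal limits ⇒ vanishing difference);
`←` is `magicFormulaT_of_loopLimitZ2EqT` plus `X ⇒ crux`. [folklore] -/
theorem cruxPair_iff_target_and_transfer (h2 : MagicFormulaZ2) :
    (MagicFormulaT ∧ NestingRigidity) ↔ (LoopLimitZ2EqT ∧ TransferContinuity) :=
  ⟨fun ⟨h4, h3⟩ ↦ ⟨h3 h2 h4, transferContinuity_of_magicFormulas h2 h4⟩,
    fun ⟨hX, h9⟩ ↦ ⟨magicFormulaT_of_loopLimitZ2EqT hX h2 h9, fun _ _ ↦ hX⟩⟩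

/-- **Joint conjunct, given the support lemma `TransferContinuity`** (stmt-4838, "restrict to big
loops", arXiv:2603.06268 §5 p. 37; size M): the two open cruxes are jointly the target. [folklore] -/
theorem cruxPair_iff_target (h2 : MagicFormulaZ2) (h9 : TransferContinuity) :
    (MagicFormulaT ∧ NestingRigidity) ↔ LoopLimitZ2EqT :=
  ⟨fun ⟨h4, h3⟩ ↦ h3 h2 h4, fun hX ↦ ((cruxPair_iff_target_and_transfer h2).2 ⟨hX, h9⟩)⟩

/-- The same with the cited Literature fact in place of the route item `MagicFormulaZ2`
(`magicFormulaZ2_of_dklm2026`, landed). [folklore] -/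
theorem cruxPair_iff_target' (hDKLM : dklm2026_corollary10) (h9 : TransferContinuity) :
    (MagicFormulaT ∧ NestingRigidity) ↔ LoopLimitZ2EqT :=
  cruxPair_iff_target (magicFormulaZ2_of_dklm2026 hDKLM) h9

/-- **The two open cruxes reach the conjunct modulo the cited fact only.** [folklore] -/
theorem cardyFormulaZ2_of_cruxPair (hDKLM : dklm2026_corollary10) (h4 : MagicFormulaT)
    (h3 : NestingRigidity) : _root_.CardyFormulaZ2 :=
  cardyFormulaZ2_of_nestingRigidity (magicFormulaZ2_of_dklm2026 hDKLM) h4 h3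

/-- `MagicFormulaT` is a CONSEQUENCE of the target (given the cited fact and the support lemma), so in
the bridge split `T ∧ (T → X)` the piece `T = MagicFormulaT` is implied by `X` and the piece
`T → X` is `NestingRigidity`. [folklore] -/
theorem magicFormulaT_of_target (hDKLM : dklm2026_corollary10) (h9 : TransferContinuity)
    (hX : LoopLimitZ2EqT) : MagicFormulaT :=
  magicFormulaT_of_loopLimitZ2EqT hX (magicFormulaZ2_of_dklm2026 hDKLM) h9

/-! ## §3 The Gaussian value is inert: the crux in relative form -/

/-- **Electric agreement** of bond-ℤ² and site-𝕋: for every admissible test function the two lattice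
`μ = 1/6` nesting transforms have asymptotically equal values, `Λ^{ℤ²}_δ(f) − Λ^{𝕋}_δ(f) → 0` as
`δ → 0⁺`.  Verbatim the conclusion of the support item `TransferContinuity` (which is
`LoopLimitZ2EqT → ElectricAgreement`, `transferContinuity_iff`); no limit value is named. [folklore] -/
def ElectricAgreement : Prop :=
  ∀ (f : ℂ → ℝ) (R C : ℝ), Measurable f → (∀ z, |f z| ≤ C) → (∀ z, R < ‖z‖ → f z = 0) → ∫ z, f z = 0 → Filter.Tendsto (fun δ : ℝ ↦ (fun δ : ℝ ↦ ∫ cfg, (∏ᶠ u ∈ ((Literature.Probability.Percolation.bondLoopConfig δ 0 cfg).F 0 ∪ (Literature.Probability.Percolation.bondLoopConfig δ 0 cfg).F 1), 2 * Real.cos ((∫ z in {z : ℂ | u.wind z ≠ 0}, f z) + Real.pi / 3)) ∂(Literature.Probability.Percolation.bondPercolation (Literature.Probability.LatticeModels.zdGraph 2) Literature.Probability.Percolation.half)) δ - (fun δ : ℝ ↦ ∫ cfg, (∏ᶠ u ∈ {u : Literature.Probability.RandomPlanarGeometry.UnbasedLoop ℂ | ∃ (v : Literature.Probability.LatticeModels.HexVertex)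 (γ : Literature.Probability.LatticeModels.hexGraph.Walk v v), Literature.Probability.Percolation.IsSiteInterfaceLoop cfg γ ∧ u = Literature.Probability.RandomPlanarGeometry.UnbasedLoop.mk (Literature.Probability.RandomPlanarGeometry.BasedLoop.mk (Literature.Probability.Percolation.siteLoopCurve δ γ) (Literature.Probability.Percolation.isLoop_siteLoopCurve δ γ))}, 2 * Real.cos ((∫ z in {z : ℂ | u.wind z ≠ 0}, f z) + Real.pi / 3)) ∂(Literature.Probability.LatticeModels.triSitePercolation Literature.Probability.Percolation.half)) δ) (nhdsWithin 0 (Set.Ioi 0)) (nhds 0)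

/-- `TransferContinuity` is literally `X → ElectricAgreement`. [folklore] -/
theorem transferContinuity_iff : TransferContinuity ↔ (LoopLimitZ2EqT → ElectricAgreement) := Iff.rfl

/-- Both magic formulas give electric agreement outright (equal limits). [folklore] -/
theorem electricAgreement_of_magicFormulas (h2 : MagicFormulaZ2) (h4 : MagicFormulaT) :
    ElectricAgreement := by
  intro f R C hf hC hR h0
  have key := (h2 f R C hf hC hR h0).sub (h4 f R C hf hC hR h0)
  rw [sub_self] at key
  exact key

/-- Electric agreement and the ℤ² magic formula give the 𝕋 magic formula
(`Λ^𝕋 = Λ^{ℤ²} − (Λ^{ℤ²} − Λ^𝕋) → G − 0`). [folklore] -/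
theorem magicFormulaT_of_electricAgreement (h2 : MagicFormulaZ2) (hEA : ElectricAgreement) :
    MagicFormulaT := by
  intro f R C hf hC hR h0
  have key := (h2 f R C hf hC hR h0).sub (hEA f R C hf hC hR h0)
  simp only [sub_sub_cancel, sub_zero] at key
  exact key

/-- Given the ℤ² magic formula, the 𝕋 magic formula IS electric agreement. [folklore] -/
theorem magicFormulaT_iff_electricAgreement (h2 : MagicFormulaZ2) :
    MagicFormulaT ↔ ElectricAgreement :=
  ⟨electricAgreement_of_magicFormulas h2, magicFormulaT_of_electricAgreement h2⟩

/-- **The crux in relative form.**  Given the cited ℤ² magic formula, `NestingRigidity` is equivalent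
to `ElectricAgreement → LoopLimitZ2EqT`, a statement in which the Gaussian functional
`exp((3/4π²)∬ log‖x−y‖ f f)` does not occur.  (`←` does not even use `h2`.) [folklore] -/
theorem nestingRigidity_iff_relative (h2 : MagicFormulaZ2) :
    NestingRigidity ↔ (ElectricAgreement → LoopLimitZ2EqT) :=
  ⟨fun h3 hEA ↦ h3 h2 (magicFormulaT_of_electricAgreement h2 hEA),
    fun h hZ hT ↦ h (electricAgreement_of_magicFormulas hZ hT)⟩

/-- The relative form implies the crux unconditionally. [folklore] -/
theorem nestingRigidity_of_relative (h : ElectricAgreement → LoopLimitZ2EqT) : NestingRigidity :=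
  fun hZ hT ↦ h (electricAgreement_of_magicFormulas hZ hT)

/-- **The route's open transform content, normal form.**  Modulo the cited fact, the two open cruxes
are `ElectricAgreement` and `ElectricAgreement → X`: a bridge split of the target through electric
agreement. [folklore] -/
theorem cruxPair_iff_bridge (h2 : MagicFormulaZ2) :
    (MagicFormulaT ∧ NestingRigidity) ↔ (ElectricAgreement ∧ (ElectricAgreement → LoopLimitZ2EqT)) :=
  Iff.and (magicFormulaT_iff_electricAgreement h2) (nestingRigidity_iff_relative h2)

/-! ## §4 Negative rung: the magic ellipse (two-point electric data do not determine nesting laws) -/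

/-- The `μ = 1/6` loop weight `w(x) = cos_μ(x)·2cos(π/3)·… = 2cos(x + π/3)`. [folklore] -/
def magicWeight (x : ℝ) : ℝ := 2 * Real.cos (x + π / 3)

/-- `w(x) = cos x − √3 sin x`. [folklore] -/
theorem magicWeight_eq (x : ℝ) : magicWeight x = Real.cos x - Real.sqrt 3 * Real.sin x := by
  unfold magicWeight
  rw [Real.cos_add, Real.cos_pi_div_three, Real.sin_pi_div_three]
  ring

/-- `w(0) = 1`: loops not separating the charges are invisible. [folklore] -/
theorem magicWeight_zero : magicWeight 0 = 1 := by
  rw [magicWeight_eq]; simp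

/-- **The magic ellipse identity**: `w(λ)² + w(λ)w(−λ) + w(−λ)² = 3` for every real `λ` — the
two-point magic data `(w(λ), w(−λ))` range over the ellipse `u² + uv + v² = 3`, on which this quadratic
polynomial with coefficient signs `(+,+,+ ; −3)` vanishes. [folklore] -/
theorem magicWeight_ellipse (l : ℝ) :
    magicWeight l ^ 2 + magicWeight l * magicWeight (-l) + magicWeight (-l) ^ 2 = 3 := by
  rw [magicWeight_eq, magicWeight_eq, Real.cos_neg, Real.sin_neg]
  have h3 : Real.sqrt 3 ^ 2 = 3 := Real.sq_sqrt (by norm_num)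
  have hcs : Real.sin l ^ 2 + Real.cos l ^ 2 = 1 := Real.sin_sq_add_cos_sq l
  nlinarith [h3, hcs]

/-- **The ellipse move**: for all exponents `m n`, replacing mass at `(m, n)` by one third of that mass
at each of `(m+2, n)`, `(m+1, n+1)`, `(m, n+2)` leaves every two-point magic datum unchanged. [folklore] -/
theorem magicWeight_ellipse_move (m n : ℕ) (l : ℝ) :
    magicWeight l ^ (m + 2) * magicWeight (-l) ^ n + magicWeight l ^ (m + 1) * magicWeight (-l) ^ (n + 1)
      + magicWeight l ^ m * magicWeight (-l) ^ (n + 2) = 3 * (magicWeight l ^ m * magicWeight (-l) ^ n) := by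
  have h := magicWeight_ellipse l
  have : magicWeight l ^ (m + 2) * magicWeight (-l) ^ n
      + magicWeight l ^ (m + 1) * magicWeight (-l) ^ (n + 1)
      + magicWeight l ^ m * magicWeight (-l) ^ (n + 2)
      = (magicWeight l ^ 2 + magicWeight l * magicWeight (-l) + magicWeight (-l) ^ 2)
        * (magicWeight l ^ m * magicWeight (-l) ^ n) := by ring
  rw [this, h]

/-- The four atoms `(0,0), (2,0), (1,1), (0,2)` of `ℕ × ℕ`. [folklore] -/
def ellipseAtoms : Finset (ℕ × ℕ) := {(0, 0), (2, 0), (1, 1), (0, 2)}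

/-- Law A of a pair of nesting counts: the point mass at `(0, 0)`. [folklore] -/
def lawA : ℕ × ℕ → ℝ := fun x ↦ if x = (0, 0) then 1 else 0

/-- Law B(ε): mass `1 − ε` at `(0,0)` and `ε/3` at each of `(2,0), (1,1), (0,2)`. [folklore] -/
def lawB (ε : ℝ) : ℕ × ℕ → ℝ := fun x ↦
  if x = (0, 0) then 1 - ε else if x ∈ ({(2, 0), (1, 1), (0, 2)} : Finset (ℕ × ℕ)) then ε / 3 else 0

/-- The two-point magic transform `E_p[w(λ)^{N₁} w(−λ)^{N₂}]` of a law `p` carried by the four atoms.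
[folklore] -/
def magicTransform2 (p : ℕ × ℕ → ℝ) (l : ℝ) : ℝ :=
  ∑ x ∈ ellipseAtoms, p x * (magicWeight l ^ x.1 * magicWeight (-l) ^ x.2)

/-- Law A is a probability law on the atoms. [folklore] -/
theorem lawA_prob : (∀ x, 0 ≤ lawA x) ∧ ∑ x ∈ ellipseAtoms, lawA x = 1 := by
  refine ⟨fun x ↦ by unfold lawA; split_ifs <;> norm_num, ?_⟩
  simp [ellipseAtoms, lawA]

/-- Law B(ε) is a probability law on the atoms for `0 ≤ ε ≤ 1`. [folklore] -/
theorem lawB_prob {ε : ℝ} (h0 : 0 ≤ ε) (h1 : ε ≤ 1) :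
    (∀ x, 0 ≤ lawB ε x) ∧ ∑ x ∈ ellipseAtoms, lawB ε x = 1 := by
  refine ⟨fun x ↦ ?_, ?_⟩
  · unfold lawB
    split_ifs <;> linarith
  · simp [ellipseAtoms, lawB]
    ring

/-- The two laws differ as soon as `ε ≠ 0` (they differ at the atom `(0,0)`). [folklore] -/
theorem lawA_ne_lawB {ε : ℝ} (hε : ε ≠ 0) : lawA ≠ lawB ε := by
  intro h
  have := congrFun h (0, 0)
  simp [lawA, lawB] at this
  exact hε (by linarith)

/-- **Two-point electric non-uniqueness (negative rung for the wall).**  For EVERY `ε` and EVERY `λ`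
the two laws have the same two-point magic datum: `E_A[w(λ)^{N₁}w(−λ)^{N₂}] = E_{B(ε)}[…] = 1`.
With `lawA_prob`, `lawB_prob`, `lawA_ne_lawB`: distinct probability laws of `(N₁, N₂)`, identical
electric two-point data for all charges `±λ` — positivity and normalisation do not make the `k`-point
reduction of the nesting transform injective. [folklore] -/
theorem magicTransform2_lawA_eq_lawB (ε l : ℝ) :
    magicTransform2 lawA l = magicTransform2 (lawB ε) l := by
  have h := magicWeight_ellipse l
  have eA : magicTransform2 lawA l = 1 := by simp [magicTransform2, ellipseAtoms, lawA]
  have eB : magicTransform2 (lawB ε) l = (1 - ε) + ε / 3 *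
      (magicWeight l ^ 2 + magicWeight l * magicWeight (-l) + magicWeight (-l) ^ 2) := by
    simp [magicTransform2, ellipseAtoms, lawB]
    ring
  rw [eA, eB, h]
  ring

/-- Both transforms are identically `1` (= `w(0)^{everything}`: "no separating loops"). [folklore] -/
theorem magicTransform2_lawA (l : ℝ) : magicTransform2 lawA l = 1 := by
  simp [magicTransform2, ellipseAtoms, lawA]

end Summit.CriticalPhenomena.CardyFormulaZ2.Cruxes.NestingRigidity.SummitStrength

end
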